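import Literature.Analysis.FunctionSpaces.WeakLpQuantitative
import HarnessLib

/-!
# C177 `Wu2026` — toward `Step_341` (§3.3): weak-`L^p` algebra
# (sums, domination, squares of norms, membership from real-level bounds)

Seat `ns-in-wu-341` (D-0154 (2) INPUTS, director-ns req136; A3 Wu 2026, KEY `Step_341`), filed in the
salvage namespace `…Theorems.Wu2026Salvage` (theorems only, standard axioms, no definition, no named
fact). Elementary properties of the tree's weak-`L^p` class `Literature.Analysis.FunctionSpaces.MemWeakLp`
(`WeakLp.lean`: `eWeakLpPow f p μ = sup_{t ≥ 0} t^p μ{t < ‖f‖}`, `MemWeakLp = AEStronglyMeasurable ∧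
eWeakLpPow < ∞`) that `Step_341` consumes and that the tree does not yet state by name
(`lean search 'MemWeakLp\.(add|mono|norm)'`: nothing):

* `eWeakLpPow_le_of_forall` / `memWeakLp_of_forall` — membership from a bound
  `t^p μ{t < ‖f‖} ≤ M` at every REAL level `t > 0` (the level `0` contributes `0`; pattern of the
  tree's `eWeakLpPow_three_le_of_forall`, general exponent);
* `memWeakLp_mono_norm` — domination `‖g‖ ≤ ‖f‖` pointwise preserves membership;
* `memWeakLp_add` — `L^{p,∞}` is closed under sums, `‖f + g‖^p_{p,∞} ≤ 2^p (‖f‖^p_{p,∞} + ‖g‖^p_{p,∞})`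
  (Grafakos, *Classical Fourier Analysis*, 1.1.10: `L^{p,∞}` is a quasi-normed space);
* `memWeakLp_norm_sq` — `f ∈ L^{p,∞} ⇒ |f|² ∈ L^{p/2,∞}` (stated with `p.toReal = 2 q.toReal`);
* `memWeakLp_add_half_norm_sq` — the consumed combination: `q ∈ L^{r,∞}`, `v ∈ L^{p,∞}`, `p = 2r` ⇒
  `q + |v|²/2 ∈ L^{r,∞}` (the shape of Wu's Bernoulli function `𝒬 = p + |v|²/2`, (3.41)).

WHAT THIS IS NOT: not a claim about NS regularity or blow-up; not a claim about any author beyond the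
typed locator.
-/

noncomputable section

set_option linter.dupNamespace false

open MeasureTheory Set Function Filter Topology
open scoped ENNReal NNReal

namespace Summit.NavierStokesRegularity.NavierStokesRegularity.Theorems.Wu2026Salvage

open Literature.Analysis.FunctionSpaces

variable {α : Type*} [MeasurableSpace α] {E F : Type*} [NormedAddCommGroup E] [NormedAddCommGroup F]
variable {μ : Measure α} {p : ℝ≥0∞}

/-! ### Membership from bounds at real levels -/

/-- `sup_{t ≥ 0} t^p μ{t < ‖f‖} ≤ M` from the bound at every real height `σ > 0` (the height `0`
contributes `0` since `0 < p`). [folklore] -/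
theorem eWeakLpPow_le_of_forall {f : α → E} (hp : 0 < p.toReal) {M : ℝ≥0∞}
    (h : ∀ σ : ℝ, 0 < σ → ENNReal.ofReal (σ ^ p.toReal) * μ {x | σ < ‖f x‖} ≤ M) :
    eWeakLpPow f p μ ≤ M := by
  unfold eWeakLpPow
  refine iSup_le fun t => ?_
  rcases eq_or_ne t 0 with rfl | ht
  · rw [ENNReal.coe_zero, ENNReal.zero_rpow_of_pos hp, zero_mul]
    exact zero_le
  have htpos : (0 : ℝ) < t := lt_of_le_of_ne t.coe_nonneg (fun h0 => ht (by exact_mod_cast h0.symm))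
  have e1 : ((t : ℝ≥0∞)) ^ p.toReal = ENNReal.ofReal ((t : ℝ) ^ p.toReal) := by
    rw [← ENNReal.ofReal_rpow_of_pos htpos, ENNReal.ofReal_coe_nnreal]
  have e2 : {x | (t : ℝ≥0∞) < ‖f x‖ₑ} = {x | (t : ℝ) < ‖f x‖} := by
    ext x
    simp only [mem_setOf_eq]
    rw [← ofReal_norm, ← ENNReal.ofReal_coe_nnreal,
      ENNReal.ofReal_lt_ofReal_iff_of_nonneg t.coe_nonneg]
  rw [e1, e2]
  exact h t htpos

/-- A measurable function with `sup_{σ > 0} σ^p μ{σ < ‖f‖} ≤ M < ∞` at real levels is in `L^{p,∞}`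
(`0 < p < ∞`). [folklore] -/
theorem memWeakLp_of_forall {f : α → E} (hf : AEStronglyMeasurable f μ) (hp : 0 < p.toReal)
    {M : ℝ≥0∞} (hM : M < ⊤)
    (h : ∀ σ : ℝ, 0 < σ → ENNReal.ofReal (σ ^ p.toReal) * μ {x | σ < ‖f x‖} ≤ M) :
    MemWeakLp f p μ :=
  ⟨hf, lt_of_le_of_lt (eWeakLpPow_le_of_forall hp h) hM⟩

/-! ### Domination -/

/-- The weak quasinorm is monotone under pointwise domination of the norms. [folklore] -/
theorem eWeakLpPow_mono_norm {f : α → E} {g : α → F} (hle : ∀ x, ‖g x‖ ≤ ‖f x‖) :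
    eWeakLpPow g p μ ≤ eWeakLpPow f p μ := by
  unfold eWeakLpPow
  refine iSup_mono fun t => ?_
  refine mul_le_mul' le_rfl (measure_mono fun x hx => ?_)
  simp only [mem_setOf_eq] at hx ⊢
  refine lt_of_lt_of_le hx ?_
  rw [← ofReal_norm, ← ofReal_norm]
  exact ENNReal.ofReal_le_ofReal (hle x)

/-- **Domination**: if `‖g‖ ≤ ‖f‖` pointwise, `g` is measurable and `f ∈ L^{p,∞}`, then `g ∈ L^{p,∞}`.
[folklore] -/
theorem memWeakLp_mono_norm {f : α → E} {g : α → F} (hf : MemWeakLp f p μ)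
    (hg : AEStronglyMeasurable g μ) (hle : ∀ x, ‖g x‖ ≤ ‖f x‖) : MemWeakLp g p μ :=
  ⟨hg, lt_of_le_of_lt (eWeakLpPow_mono_norm hle) hf.2⟩

/-! ### Sums -/

omit [MeasurableSpace α] in
/-- The superlevel set of a sum at height `σ` lies in the union of the superlevel sets of the
summands at height `σ/2`. [folklore] -/
theorem setOf_lt_norm_add_subset (f g : α → E) (σ : ℝ) :
    {x | σ < ‖f x + g x‖} ⊆ {x | σ / 2 < ‖f x‖} ∪ {x | σ / 2 < ‖g x‖} := by
  intro x hx
  simp only [mem_setOf_eq, mem_union] at hx ⊢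
  by_contra hcon
  push Not at hcon
  have := norm_add_le (f x) (g x)
  linarith [hcon.1, hcon.2]

/-- **`L^{p,∞}` is closed under addition**, quantitatively:
`sup_σ σ^p μ{σ < ‖f + g‖} ≤ 2^p (‖f‖^p_{p,∞} + ‖g‖^p_{p,∞})` (Grafakos 1.1.10; the two superlevel sets
at height `σ/2`). [folklore] -/
theorem eWeakLpPow_add_le (f g : α → E) (hp : 0 < p.toReal) :
    eWeakLpPow (fun x => f x + g x) p μ ≤
      ENNReal.ofReal (2 ^ p.toReal) * (eWeakLpPow f p μ + eWeakLpPow g p μ) := by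
  refine eWeakLpPow_le_of_forall hp fun σ hσ => ?_
  have hσ2 : 0 < σ / 2 := by positivity
  have hf := meas_lt_norm_le_eWeakLpPow_mul_ofReal_rpow_neg f p μ hσ2
  have hg := meas_lt_norm_le_eWeakLpPow_mul_ofReal_rpow_neg g p μ hσ2
  have hkey : ENNReal.ofReal (σ ^ p.toReal) * ENNReal.ofReal ((σ / 2) ^ (-p.toReal)) =
      ENNReal.ofReal (2 ^ p.toReal) := by
    rw [← ENNReal.ofReal_mul (Real.rpow_nonneg hσ.le _)]
    congr 1
    rw [Real.rpow_neg hσ2.le, Real.div_rpow hσ.le zero_le_two, inv_div, mul_comm]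
    exact div_mul_cancel₀ _ (Real.rpow_pos_of_pos hσ _).ne'
  calc ENNReal.ofReal (σ ^ p.toReal) * μ {x | σ < ‖f x + g x‖}
      ≤ ENNReal.ofReal (σ ^ p.toReal) * (μ {x | σ / 2 < ‖f x‖} + μ {x | σ / 2 < ‖g x‖}) :=
        mul_le_mul' le_rfl ((measure_mono (setOf_lt_norm_add_subset f g σ)).trans
          (measure_union_le _ _))
    _ ≤ ENNReal.ofReal (σ ^ p.toReal) *
          (eWeakLpPow f p μ * ENNReal.ofReal ((σ / 2) ^ (-p.toReal)) +
            eWeakLpPow g p μ * ENNReal.ofReal ((σ / 2) ^ (-p.toReal))) := by gcongr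
    _ = ENNReal.ofReal (σ ^ p.toReal) * ENNReal.ofReal ((σ / 2) ^ (-p.toReal)) *
          (eWeakLpPow f p μ + eWeakLpPow g p μ) := by ring
    _ = ENNReal.ofReal (2 ^ p.toReal) * (eWeakLpPow f p μ + eWeakLpPow g p μ) := by rw [hkey]

/-- **`L^{p,∞}` is closed under addition** (`0 < p < ∞`). [folklore] -/
theorem memWeakLp_add {f g : α → E} (hf : MemWeakLp f p μ) (hg : MemWeakLp g p μ)
    (hp : 0 < p.toReal) : MemWeakLp (fun x => f x + g x) p μ := by
  refine ⟨hf.1.add hg.1, lt_of_le_of_lt (eWeakLpPow_add_le f g hp) ?_⟩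
  exact ENNReal.mul_lt_top ENNReal.ofReal_lt_top (ENNReal.add_lt_top.2 ⟨hf.2, hg.2⟩)

/-! ### Squares of norms -/

/-- **`f ∈ L^{p,∞} ⇒ |f|² ∈ L^{p/2,∞}`**, quantitatively: for `p = 2q`,
`sup_σ σ^q μ{σ < |f|²} ≤ ‖f‖^p_{p,∞}` (the superlevel set `{σ < |f|²} = {√σ < |f|}`). [folklore] -/
theorem eWeakLpPow_norm_sq_le (f : α → E) {q : ℝ≥0∞} (hpq : p.toReal = 2 * q.toReal)
    (hq : 0 < q.toReal) :
    eWeakLpPow (fun x => ‖f x‖ ^ 2) q μ ≤ eWeakLpPow f p μ := by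
  refine eWeakLpPow_le_of_forall hq fun σ hσ => ?_
  have hs : 0 < Real.sqrt σ := Real.sqrt_pos.2 hσ
  have hsub : {x | σ < ‖(‖f x‖ ^ 2)‖} ⊆ {x | Real.sqrt σ < ‖f x‖} := fun x hx => by
    simp only [mem_setOf_eq, Real.norm_eq_abs, abs_pow, abs_norm] at hx ⊢
    calc Real.sqrt σ < Real.sqrt (‖f x‖ ^ 2) := Real.sqrt_lt_sqrt hσ.le hx
      _ = ‖f x‖ := Real.sqrt_sq (norm_nonneg _)
  have hpow : σ ^ q.toReal = Real.sqrt σ ^ p.toReal := by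
    rw [hpq, Real.rpow_mul (Real.sqrt_nonneg _), Real.rpow_two, Real.sq_sqrt hσ.le]
  calc ENNReal.ofReal (σ ^ q.toReal) * μ {x | σ < ‖(‖f x‖ ^ 2)‖}
      ≤ ENNReal.ofReal (Real.sqrt σ ^ p.toReal) * μ {x | Real.sqrt σ < ‖f x‖} := by
        rw [hpow]; exact mul_le_mul' le_rfl (measure_mono hsub)
    _ ≤ eWeakLpPow f p μ := ofReal_rpow_mul_meas_lt_le_eWeakLpPow f p μ hs

/-- **`f ∈ L^{p,∞} ⇒ |f|² ∈ L^{q,∞}` for `p = 2q`**, `0 < q < ∞`. [folklore] -/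
theorem memWeakLp_norm_sq {f : α → E} (hf : MemWeakLp f p μ) {q : ℝ≥0∞}
    (hpq : p.toReal = 2 * q.toReal) (hq : 0 < q.toReal) :
    MemWeakLp (fun x => ‖f x‖ ^ 2) q μ :=
  ⟨(hf.1.norm.pow 2), lt_of_le_of_lt (eWeakLpPow_norm_sq_le f hpq hq) hf.2⟩

/-- **The Bernoulli combination**: `g ∈ L^{q,∞}`, `f ∈ L^{p,∞}` with `p = 2q`, `0 < q < ∞` ⇒
`g + |f|²/2 ∈ L^{q,∞}` (the shape of `𝒬 = p + |v|²/2`, Wu 2026 (3.41), with `(p, q) = (9/2, 9/4)`).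
[cite: Wu2026, (3.41) p.15 l.1–7] -/
theorem memWeakLp_add_half_norm_sq {g : α → ℝ} {f : α → E} {q : ℝ≥0∞} (hg : MemWeakLp g q μ)
    (hf : MemWeakLp f p μ) (hpq : p.toReal = 2 * q.toReal) (hq : 0 < q.toReal) :
    MemWeakLp (fun x => g x + ‖f x‖ ^ 2 / 2) q μ := by
  have hsq := memWeakLp_norm_sq hf hpq hq
  have hhalf : MemWeakLp (fun x => ‖f x‖ ^ 2 / 2) q μ := by
    refine memWeakLp_mono_norm hsq
      ((continuous_id.div_const (2 : ℝ)).comp_aestronglyMeasurable hsq.1) fun x => ?_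
    rw [Real.norm_eq_abs, Real.norm_eq_abs, abs_div, abs_two]
    exact div_le_self (abs_nonneg _) one_le_two
  exact memWeakLp_add hg hhalf hq

end Summit.NavierStokesRegularity.NavierStokesRegularity.Theorems.Wu2026Salvage

end

-- WHAT THIS IS NOT: not a claim about NS regularity or blow-up; not a claim about any author beyond the typed locator.
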